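import Summits.Parity.GeneralizedHardyLittlewood.Theses.LiouvilleMAD
import Summits.Parity.GeneralizedHardyLittlewood.Theorems.CosetDecorrelation.Negative.CosetDecorrelationDegenerations
import Literature.NumberTheory.LFunctions.KloostermanFractionsAmplifier
import Literature.NumberTheory.LFunctions.RHWave0

/-!
# SketchIdeator4 — crux `CosetDecorrelation` (stmt-Parity-13317), crux-ideate round 2, ideator 4
# card `jacobi-family-bridge` (the q-ASPECT zero side of the coset sum)

Crux (route `LiouvilleMAD`, rank 2): `∀ c ≠ 0, ∃ ϑ < 1/4, ∃ C, ∀ M, 1 ≤ n ≠ n' ≤ 2M, j ∈ [⌊√M⌋+1, 2⌊√M⌋+2):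
|T_j(n,n';c,M)| ≤ C·M^{3/4+ϑ}`, `T_j = Σ_{(m,m')∈(M,2M]², m≡m' (j)} λ(mn+c)λ(m'n'+c)` (`Negative.T`).

What this file checks (everything `sorry`-free; `lean check` rc 0):

* §1 FIRST LEMMA, PROVED: `mulPlancherel` — multiplicative Plancherel on `(ℤ/m)ˣ`:
  `Σ_χ (Σ_a f(a)χ(a))(Σ_b g(b)conj χ(b)) = φ(m)·Σ_{a unit} f(a)g(a)`.  With `f = A_n`, `g = A_{n'}` (class-sum
  profiles on `ℤ/j`) this is the character-coordinate form of the unit part of `T_j = Σ_a A_n(a)A_{n'}(a)`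
  (`Negative.cosetW_eq_classInner`); with characters mod `jn`, `jn'` of `k = mn+c` it is the L-function
  coordinate form of §3 (orthogonality twice; stated as the Prop `CharacterCoordinates`, provable bookkeeping).
* §2 SPLIT GLUE, PROVED (for the two-layer plan's foreseen split `CosetSmallDilations → CosetLargeDilations → crux`):
  `SmallDilationCoset η`, `LargeDilationCoset η` and `cosetDecorrelation_of_small_large`,
  `small_of_cosetDecorrelation`, `large_of_cosetDecorrelation`, `cosetDecorrelation_iff_small_large`.
* §3 THE ZERO SIDE, TYPED (defs/Props only, nothing claimed): `charSum` (`Σ_{k∈(X,2X]} λ(k)χ(k)`, partial sums of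
  `L(2s,χ²)/L(s,χ)`), `jacobiKernel` (`K_j(χ,ψ) = Σ_{a mod j} conj χ(an+c)·conj ψ(an'+c)`), `CharacterCoordinates`,
  `lzeros`, `lioWeight` (`a_χ(ρ) = L(2ρ,χ²)/L'(ρ,χ)`), `zeroBlock`, `ClassSumExplicit A δ` (GRH-grade explicit formula at
  precision `q^A X^δ`, a HYPOTHESIS here; the row lemma forces `A/2 + δ < 1/4` for usability), `familyForm`, `FamilyPairDecorrelation η κ` (the card's conjecture-grade input: a power saving in
  the Jacobi-weighted CROSS-family pair form of zeros of `L(s,χ)`, `χ mod jn`, against `L(s,ψ)`, `ψ mod jn'` — a form with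
  NO same-L-function diagonal), `SimpleZerosFamily`, `NegMomentFamily`, and the composition SHAPE `TransferShape η`
  (a `def`, not a theorem; every hypothesis named; none mentions a coset, a fan or a correlation of `λ`).

Nothing here asserts the crux, its negation, or any stub; `sorry` appears nowhere.
-/

namespace Summit.Parity.GeneralizedHardyLittlewood.Cruxes.CosetDecorrelation.JacobiFamily

open Finset
open scoped BigOperators ComplexConjugate Classical
open Summit.Parity.GeneralizedHardyLittlewood.Theses.LiouvilleMAD
open Summit.Parity.GeneralizedHardyLittlewood.Theorems.CosetDecorrelation.Negative (u T cosetW pairs crux_iff)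

/-! ## §1 First lemma (PROVED): multiplicative Plancherel on `(ℤ/m)ˣ` -/

/-- **Multiplicative Plancherel.** For any `f g : ℤ/m → ℂ`:
`Σ_{χ mod m} (Σ_a f(a)χ(a))·(Σ_b g(b)·conj χ(b)) = φ(m)·Σ_{a unit} f(a)g(a)`.
(Orthogonality `Σ_χ χ(a)conj χ(b) = φ(m)·[b unit ∧ a = b]`, tree lemma
`Literature.NumberTheory.LFunctions.DFI_sum_char_mul_conj_char`.)  This is the change of coordinates at the root of the
card: the non-unit classes (`≤ ω(j)` per prime factor of `j`; ONE class for prime `j`) are handled separately. -/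
theorem mulPlancherel (m : ℕ) [NeZero m] (f g : ZMod m → ℂ) :
    ∑ χ : DirichletCharacter ℂ m, (∑ a : ZMod m, f a * χ a) * (∑ b : ZMod m, g b * conj (χ b)) =
      (m.totient : ℂ) * ∑ a ∈ (univ : Finset (ZMod m)).filter (fun a => IsUnit a), f a * g a := by
  have key : ∀ a b : ZMod m, ∑ χ : DirichletCharacter ℂ m, χ a * conj (χ b) =
      if IsUnit b ∧ a = b then (m.totient : ℂ) else 0 := fun a b =>
    Literature.NumberTheory.LFunctions.DFI_sum_char_mul_conj_char m b a
  calc ∑ χ : DirichletCharacter ℂ m, (∑ a : ZMod m, f a * χ a) * (∑ b : ZMod m, g b * conj (χ b))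
      = ∑ χ : DirichletCharacter ℂ m, ∑ a : ZMod m, ∑ b : ZMod m, f a * g b * (χ a * conj (χ b)) := by
        refine sum_congr rfl fun χ _ => ?_
        rw [sum_mul]
        refine sum_congr rfl fun a _ => ?_
        rw [mul_sum]
        refine sum_congr rfl fun b _ => ?_
        ring
    _ = ∑ a : ZMod m, ∑ b : ZMod m, f a * g b * ∑ χ : DirichletCharacter ℂ m, χ a * conj (χ b) := by
        rw [sum_comm]
        refine sum_congr rfl fun a _ => ?_
        rw [sum_comm]
        refine sum_congr rfl fun b _ => ?_
        rw [mul_sum]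
    _ = ∑ a : ZMod m, ∑ b : ZMod m, f a * g b * (if IsUnit b ∧ a = b then (m.totient : ℂ) else 0) := by
        simp_rw [key]
    _ = ∑ a : ZMod m, (if IsUnit a then (m.totient : ℂ) * (f a * g a) else 0) := by
        refine sum_congr rfl fun a _ => ?_
        rw [sum_eq_single a]
        · by_cases ha : IsUnit a
          · rw [if_pos ⟨ha, rfl⟩, if_pos ha]; ring
          · rw [if_neg (fun h => ha h.1), if_neg ha, mul_zero]
        · intro b _ hb
          rw [if_neg (fun h => hb h.2.symm), mul_zero]
        · intro h; exact absurd (mem_univ a) h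
    _ = (m.totient : ℂ) * ∑ a ∈ (univ : Finset (ZMod m)).filter (fun a => IsUnit a), f a * g a := by
        rw [sum_filter, mul_sum]
        refine sum_congr rfl fun a _ => ?_
        split_ifs <;> simp

/-! ## §2 Split glue (PROVED): small dilations / large dilations -/

/-- The crux restricted to dilation pairs with `n·n' ≤ M^η` (the two-layer plan's `CosetSmallDilations`, with the
threshold as a free exponent `η`; `η = 1` is "both `≤ √M` up to the product form"). -/
def SmallDilationCoset (η : ℝ) : Prop :=
  ∀ c : ℤ, c ≠ 0 → ∃ ϑ : ℝ, ϑ < 1 / 4 ∧ ∃ C : ℝ, ∀ M n n' j : ℕ, 1 ≤ n → 1 ≤ n' → n ≠ n' →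
    n ≤ 2 * M → n' ≤ 2 * M → ((n : ℝ) * n' ≤ (M : ℝ) ^ η) → Nat.sqrt M + 1 ≤ j → j < 2 * (Nat.sqrt M + 1) →
      |T c n n' M j| ≤ C * (M : ℝ) ^ (3 / 4 + ϑ)

/-- The complementary range `n·n' > M^η` (`CosetLargeDilations`): conductor `jnn'` beyond `M^{1/2+η}`, where no
explicit formula has usable error terms — PARKED by the card (no handle in either direction). -/
def LargeDilationCoset (η : ℝ) : Prop :=
  ∀ c : ℤ, c ≠ 0 → ∃ ϑ : ℝ, ϑ < 1 / 4 ∧ ∃ C : ℝ, ∀ M n n' j : ℕ, 1 ≤ n → 1 ≤ n' → n ≠ n' →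
    n ≤ 2 * M → n' ≤ 2 * M → ((M : ℝ) ^ η < (n : ℝ) * n') → Nat.sqrt M + 1 ≤ j → j < 2 * (Nat.sqrt M + 1) →
      |T c n n' M j| ≤ C * (M : ℝ) ^ (3 / 4 + ϑ)

theorem small_of_cosetDecorrelation (η : ℝ) (h : CosetDecorrelation) : SmallDilationCoset η := by
  intro c hc
  obtain ⟨ϑ, hϑ, C, hC⟩ := (crux_iff.mp h) c hc
  exact ⟨ϑ, hϑ, C, fun M n n' j h1 h2 h3 h4 h5 _ h7 h8 => hC M n n' j h1 h2 h3 h4 h5 h7 h8⟩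

theorem large_of_cosetDecorrelation (η : ℝ) (h : CosetDecorrelation) : LargeDilationCoset η := by
  intro c hc
  obtain ⟨ϑ, hϑ, C, hC⟩ := (crux_iff.mp h) c hc
  exact ⟨ϑ, hϑ, C, fun M n n' j h1 h2 h3 h4 h5 _ h7 h8 => hC M n n' j h1 h2 h3 h4 h5 h7 h8⟩

/-- GLUE for the split: the two ranges together give the crux (`ϑ := max ϑ₁ ϑ₂`, `C := max C₁ C₂`, using `1 ≤ M`,
which holds whenever the dilation hypotheses `1 ≤ n ≤ 2M` are satisfiable). -/
theorem cosetDecorrelation_of_small_large (η : ℝ) (hS : SmallDilationCoset η) (hL : LargeDilationCoset η) :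
    CosetDecorrelation := by
  rw [crux_iff]
  intro c hc
  obtain ⟨ϑ₁, hϑ₁, C₁, hC₁⟩ := hS c hc
  obtain ⟨ϑ₂, hϑ₂, C₂, hC₂⟩ := hL c hc
  refine ⟨max ϑ₁ ϑ₂, max_lt hϑ₁ hϑ₂, max (max C₁ C₂) 0, fun M n n' j h1 h2 h3 h4 h5 h7 h8 => ?_⟩
  have hM : (1 : ℝ) ≤ (M : ℝ) := by exact_mod_cast (show 1 ≤ M by omega)
  have mono : ∀ (ϑ C : ℝ), ϑ ≤ max ϑ₁ ϑ₂ → C ≤ max (max C₁ C₂) 0 →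
      |T c n n' M j| ≤ C * (M : ℝ) ^ (3 / 4 + ϑ) →
        |T c n n' M j| ≤ max (max C₁ C₂) 0 * (M : ℝ) ^ (3 / 4 + max ϑ₁ ϑ₂) := by
    intro ϑ C hϑ hCle hb
    have hpow : (M : ℝ) ^ (3 / 4 + ϑ) ≤ (M : ℝ) ^ (3 / 4 + max ϑ₁ ϑ₂) :=
      Real.rpow_le_rpow_of_exponent_le hM (by linarith)
    have hpos : 0 ≤ (M : ℝ) ^ (3 / 4 + ϑ) := Real.rpow_nonneg (by positivity) _
    calc |T c n n' M j| ≤ C * (M : ℝ) ^ (3 / 4 + ϑ) := hb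
      _ ≤ max (max C₁ C₂) 0 * (M : ℝ) ^ (3 / 4 + ϑ) := mul_le_mul_of_nonneg_right hCle hpos
      _ ≤ max (max C₁ C₂) 0 * (M : ℝ) ^ (3 / 4 + max ϑ₁ ϑ₂) :=
          mul_le_mul_of_nonneg_left hpow (le_max_right _ _)
  by_cases hsmall : (n : ℝ) * n' ≤ (M : ℝ) ^ η
  · exact mono ϑ₁ C₁ (le_max_left _ _) ((le_max_left _ _).trans (le_max_left _ _))
      (hC₁ M n n' j h1 h2 h3 h4 h5 hsmall h7 h8)
  · exact mono ϑ₂ C₂ (le_max_right _ _) ((le_max_right _ _).trans (le_max_left _ _))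
      (hC₂ M n n' j h1 h2 h3 h4 h5 (lt_of_not_ge hsmall) h7 h8)

theorem cosetDecorrelation_iff_small_large (η : ℝ) :
    CosetDecorrelation ↔ SmallDilationCoset η ∧ LargeDilationCoset η :=
  ⟨fun h => ⟨small_of_cosetDecorrelation η h, large_of_cosetDecorrelation η h⟩,
    fun h => cosetDecorrelation_of_small_large η h.1 h.2⟩

/-! ## §3 The q-aspect zero side (typed; defs and Props only) -/

/-- `Λ_χ(X) = Σ_{k ∈ (X,2X]} λ(k)χ(k)`: partial sums of the coefficients of `L(2s,χ²)/L(s,χ)`. -/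
noncomputable def charSum (q : ℕ) (χ : DirichletCharacter ℂ q) (X : ℕ) : ℂ :=
  ∑ k ∈ Ioc X (2 * X), (ArithmeticFunction.liouville k : ℂ) * χ (k : ZMod q)

/-- The JACOBI KERNEL `K_j(χ,ψ) = Σ_{a mod j} conj χ(an+c)·conj ψ(an'+c)` for `χ mod jn`, `ψ mod jn'`: a complete
character sum of two affine maps; for prime `j ∤ nn'c(n−n')` and both `j`-components non-principal it is a Jacobi
sum up to a root of unity (`|K| = √j`), it has size `O(1)` when exactly one `j`-component is principal or when the
two `j`-components are inverse to each other ("same L-function" pairs), and `K = j − O(1)` at the principal pair. -/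
noncomputable def jacobiKernel (j n n' : ℕ) (c : ℤ) [NeZero (j * n)] [NeZero (j * n')]
    (χ : DirichletCharacter ℂ (j * n)) (ψ : DirichletCharacter ℂ (j * n')) : ℂ :=
  ∑ a ∈ range j, conj (χ (((a : ℤ) * n + c : ℤ) : ZMod (j * n))) * conj (ψ (((a : ℤ) * n' + c : ℤ) : ZMod (j * n')))

/-- CHARACTER COORDINATES (provable bookkeeping: orthogonality mod `jn` and mod `jn'`, i.e. `mulPlancherel` twice; not
proved in this sketch).  When `(c, jnn') = 1` every class `an+c` is a unit mod `jn` and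
`T_j(n,n';c,M) = (φ(jn)φ(jn'))⁻¹ Σ_{χ mod jn} Σ_{ψ mod jn'} K_j(χ,ψ) Λ_χ(nM; c) Λ_ψ(n'M; c)` with the windows
`(nM+c, 2nM+c]`; here stated with the window `(nM, 2nM]` of `charSum` and an explicit edge allowance `4|c|·(2M/j+1)`. -/
def CharacterCoordinates : Prop :=
  ∀ (c : ℤ) (M j n n' : ℕ) [NeZero (j * n)] [NeZero (j * n')], 1 ≤ n → 1 ≤ n' → 1 ≤ j →
    Int.gcd c (j * n * n') = 1 →
      ‖(T c n n' M j : ℂ) - ((((j * n).totient : ℂ) * ((j * n').totient : ℂ))⁻¹ *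
          ∑ χ : DirichletCharacter ℂ (j * n), ∑ ψ : DirichletCharacter ℂ (j * n'),
            jacobiKernel j n n' c χ ψ * charSum (j * n) χ (n * M) * charSum (j * n') ψ (n' * M))‖
        ≤ 4 * |(c : ℝ)| * (2 * M / j + 1)

/-- **ROW LEMMA (PROVED).** For every `χ mod jn` the row `ψ ↦ K_j(χ,ψ)` has `Σ_ψ |K_j(χ,ψ)|² ≤ j·φ(jn')`
(orthogonality mod `jn'` plus injectivity of `a ↦ an'+c (mod jn')` on `a < j`).  With Cauchy–Schwarz in `ψ` this bounds the
total contribution of ONE character `χ mod jn` to the character-coordinate form by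
`|Λ_χ|·(j·φ(jn'))^{1/2}·‖Λ'‖₂/(φ(jn)φ(jn')) = |Λ_χ|·(j·V')^{1/2}/φ(jn) ≍ |Λ_χ|·M^{1/4}·(n')^{1/2}/n`
(`‖Λ'‖₂² = φ(jn')·V'`, `V' = Σ_{r unit mod jn'}|Σ_{k∈K_{n'}, k≡r}λ(k)|² ≍ n'M` by Plancherel), i.e. `≤ M^{3/4+ε}(n'/n)^{1/2}` under GRH; the
same lemma with `(n,χ) ↔ (n',ψ)` (the kernel is symmetric) bounds one `ψ mod jn'` by `M^{3/4+ε}(n/n')^{1/2}`.  So in the family attached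
to the LARGER dilation NO SINGLE CHARACTER (no single pretender / exceptional zero) can produce `|T_j| ≥ M^{1−κ}` — a violation needs
coherence among `≳ M^{1/4−κ}` of its characters — and in the small-dilation regime `nn' ≤ M^η` the same holds for both families. -/
theorem jacobiKernel_row_sq_sum (j n n' : ℕ) (c : ℤ) [NeZero (j * n)] [NeZero (j * n')] (hn' : 1 ≤ n')
    (χ : DirichletCharacter ℂ (j * n)) :
    ∑ ψ : DirichletCharacter ℂ (j * n'), ‖jacobiKernel j n n' c χ ψ‖ ^ 2 ≤ (j : ℝ) * ((j * n').totient : ℝ) := by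
  set x : ℕ → ZMod (j * n) := fun a => (((a : ℤ) * n + c : ℤ) : ZMod (j * n)) with hx
  set y : ℕ → ZMod (j * n') := fun a => (((a : ℤ) * n' + c : ℤ) : ZMod (j * n')) with hy
  have hK : ∀ ψ : DirichletCharacter ℂ (j * n'),
      jacobiKernel j n n' c χ ψ = ∑ a ∈ range j, conj (χ (x a)) * conj (ψ (y a)) := fun ψ => rfl
  -- injectivity of `a ↦ y a` on `range j`
  have hinj : ∀ a ∈ range j, ∀ a' ∈ range j, y a' = y a → a' = a := by
    intro a ha a' ha' h
    have ha2 : a < j := mem_range.mp ha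
    have ha2' : a' < j := mem_range.mp ha'
    have hd : ((j * n' : ℕ) : ℤ) ∣ ((a : ℤ) * n' + c) - ((a' : ℤ) * n' + c) :=
      (ZMod.intCast_eq_intCast_iff_dvd_sub _ _ _).mp h
    have hd' : ((j : ℤ) * n') ∣ ((a : ℤ) - a') * n' := by
      have e : ((a : ℤ) * n' + c) - ((a' : ℤ) * n' + c) = ((a : ℤ) - a') * n' := by ring
      rw [e] at hd
      exact_mod_cast hd
    have hn0 : (n' : ℤ) ≠ 0 := by exact_mod_cast (show n' ≠ 0 by omega)
    have hjd : (j : ℤ) ∣ (a : ℤ) - a' := (mul_dvd_mul_iff_right hn0).mp hd'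
    have hmod : (a' : ℤ) ≡ a [ZMOD j] := Int.modEq_iff_dvd.mpr hjd
    have e1 : (a' : ℤ) % j = a' := Int.emod_eq_of_lt (by positivity) (by exact_mod_cast ha2')
    have e2 : (a : ℤ) % j = a := Int.emod_eq_of_lt (by positivity) (by exact_mod_cast ha2)
    have : (a' : ℤ) = a := by rw [← e1, ← e2]; exact hmod
    exact_mod_cast this
  -- orthogonality mod jn'
  have hsum : ∑ ψ : DirichletCharacter ℂ (j * n'),
      jacobiKernel j n n' c χ ψ * conj (jacobiKernel j n n' c χ ψ)
        = ∑ a ∈ range j, conj (χ (x a)) * χ (x a) *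
            (if IsUnit (y a) then (((j * n').totient : ℕ) : ℂ) else 0) := by
    calc ∑ ψ : DirichletCharacter ℂ (j * n'), jacobiKernel j n n' c χ ψ * conj (jacobiKernel j n n' c χ ψ)
        = ∑ ψ : DirichletCharacter ℂ (j * n'), ∑ a ∈ range j, ∑ a' ∈ range j,
            conj (χ (x a)) * χ (x a') * (ψ (y a') * conj (ψ (y a))) := by
          refine sum_congr rfl fun ψ _ => ?_
          rw [hK ψ, map_sum, sum_mul]
          refine sum_congr rfl fun a _ => ?_
          rw [mul_sum]
          refine sum_congr rfl fun a' _ => ?_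
          simp only [map_mul, Complex.conj_conj]
          ring
      _ = ∑ a ∈ range j, ∑ a' ∈ range j, conj (χ (x a)) * χ (x a') *
            ∑ ψ : DirichletCharacter ℂ (j * n'), ψ (y a') * conj (ψ (y a)) := by
          rw [sum_comm]
          refine sum_congr rfl fun a _ => ?_
          rw [sum_comm]
          refine sum_congr rfl fun a' _ => ?_
          rw [mul_sum]
      _ = ∑ a ∈ range j, ∑ a' ∈ range j, conj (χ (x a)) * χ (x a') *
            (if IsUnit (y a) ∧ y a' = y a then (((j * n').totient : ℕ) : ℂ) else 0) := by
          refine sum_congr rfl fun a _ => sum_congr rfl fun a' _ => ?_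
          rw [Literature.NumberTheory.LFunctions.DFI_sum_char_mul_conj_char]
      _ = ∑ a ∈ range j, conj (χ (x a)) * χ (x a) *
            (if IsUnit (y a) then (((j * n').totient : ℕ) : ℂ) else 0) := by
          refine sum_congr rfl fun a ha => ?_
          rw [sum_eq_single a]
          · by_cases hu : IsUnit (y a)
            · rw [if_pos ⟨hu, rfl⟩, if_pos hu]
            · rw [if_neg (fun h => hu h.1), if_neg hu]
          · intro a' ha' hne
            rw [if_neg (fun h => hne (hinj a ha a' ha' h.2)), mul_zero]
          · intro h; exact absurd ha h
  -- pass to norms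
  have hre : ∑ ψ : DirichletCharacter ℂ (j * n'), ‖jacobiKernel j n n' c χ ψ‖ ^ 2
      = (∑ ψ : DirichletCharacter ℂ (j * n'), jacobiKernel j n n' c χ ψ * conj (jacobiKernel j n n' c χ ψ)).re := by
    rw [Complex.re_sum]
    refine sum_congr rfl fun ψ _ => ?_
    rw [Complex.mul_conj, Complex.ofReal_re, Complex.normSq_eq_norm_sq]
  rw [hre, hsum, Complex.re_sum]
  calc ∑ a ∈ range j, (conj (χ (x a)) * χ (x a) *
          (if IsUnit (y a) then (((j * n').totient : ℕ) : ℂ) else 0)).re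
      ≤ ∑ _a ∈ range j, ((j * n').totient : ℝ) := by
        refine sum_le_sum fun a _ => ?_
        have hns : conj (χ (x a)) * χ (x a) = (Complex.normSq (χ (x a)) : ℂ) := by
          rw [mul_comm, Complex.mul_conj]
        have hle : Complex.normSq (χ (x a)) ≤ 1 := by
          rw [Complex.normSq_eq_norm_sq]
          have h1 : ‖χ (x a)‖ ≤ 1 := DirichletCharacter.norm_le_one χ (x a)
          have h0 : 0 ≤ ‖χ (x a)‖ := norm_nonneg _
          nlinarith
        rw [hns]
        split_ifs
        · rw [← Complex.ofReal_natCast, ← Complex.ofReal_mul, Complex.ofReal_re]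
          have hφ : (0 : ℝ) ≤ ((j * n').totient : ℝ) := Nat.cast_nonneg _
          nlinarith
        · simp
    _ = (j : ℝ) * ((j * n').totient : ℝ) := by
        rw [sum_const, card_range, nsmul_eq_mul]

/-- Nontrivial zeros of `L(s,χ)` in the open critical strip up to height `T`. -/
def lzeros {q : ℕ} [NeZero q] (χ : DirichletCharacter ℂ q) (T : ℝ) : Set ℂ :=
  {ρ | χ.LFunction ρ = 0 ∧ 0 < ρ.re ∧ ρ.re < 1 ∧ |ρ.im| ≤ T}

/-- Liouville residue weight `a_χ(ρ) = L(2ρ,χ²)/L'(ρ,χ)` (the `1/ζ′`-type weight of Gonek/Ng, q-aspect). -/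
noncomputable def lioWeight {q : ℕ} [NeZero q] (χ : DirichletCharacter ℂ q) (ρ : ℂ) : ℂ :=
  (χ ^ 2).LFunction (2 * ρ) / deriv χ.LFunction ρ

/-- Zero block of one character over the window `(X,2X]`: `Z_χ(X;T) = Σ_{ρ ∈ lzeros χ T} a_χ(ρ)((2X)^ρ − X^ρ)/ρ`
(a `finsum`: the zero set is finite, junk `0` otherwise). -/
noncomputable def zeroBlock {q : ℕ} [NeZero q] (χ : DirichletCharacter ℂ q) (X T : ℝ) : ℂ :=
  ∑ᶠ ρ ∈ lzeros χ T, lioWeight χ ρ * (((2 * X : ℝ) : ℂ) ^ ρ - ((X : ℝ) : ℂ) ^ ρ) / ρ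

/-- EXPLICIT FORMULA for `λχ` at ESSENTIALLY EXACT precision (HYPOTHESIS of the line; GRH-grade: the analogue for `L(s,χ)`
of Titchmarsh Thm 14.27 / Ng 2004 (`M(x) = Σ_{|γ|<T} x^ρ/(ρζ′(ρ)) + O(x^{1+ε}/T + …)` under RH + simple zeros + Gonek–Hejhal), truncated at
`T = X`): for non-principal `χ mod q`, `Λ_χ(X) = Z_χ(X;X) + O(q^A·X^δ)` with SMALL `A, δ`.  Why this precision: an error `E` per character
propagates through the Jacobi kernel as `≤ E·(jV′)^{1/2} ≍ E·M^{3/4}` (row lemma + Cauchy–Schwarz), so the transfer needs `E ≤ M^{1/4−κ}`,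
i.e. `A/2 + δ < 1/4` and `n ≤ M^{o(1)}` — the quantitative reason the buildable range is SMALL dilations only. -/
def ClassSumExplicit (A δ : ℝ) : Prop :=
  ∃ C : ℝ, ∀ (q : ℕ) [NeZero q] (χ : DirichletCharacter ℂ q) (X : ℕ), 1 ≤ X → χ ≠ 1 →
    ‖charSum q χ X - zeroBlock χ X X‖ ≤ C * (q : ℝ) ^ A * (X : ℝ) ^ δ

/-- Simple zeros for the family (hypothesis). -/
def SimpleZerosFamily : Prop :=
  ∀ (q : ℕ) [NeZero q] (χ : DirichletCharacter ℂ q) (ρ : ℂ), χ.LFunction ρ = 0 → 0 < ρ.re → ρ.re < 1 →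
    deriv χ.LFunction ρ ≠ 0

/-- Discrete negative second moment for the family (Gonek–Hejhal / Hughes–Keating–O'Connell shape; hypothesis):
`Σ_{ρ ∈ lzeros χ T} |a_χ(ρ)|² ≤ C (qT)^B`. -/
def NegMomentFamily (B : ℝ) : Prop :=
  ∃ C : ℝ, ∀ (q : ℕ) [NeZero q] (χ : DirichletCharacter ℂ q) (T : ℝ), 1 ≤ T →
    ∑ᶠ ρ ∈ lzeros χ T, ‖lioWeight χ ρ‖ ^ 2 ≤ C * ((q : ℝ) * T) ^ B

/-- The CROSS-FAMILY PAIR FORM: `𝓕_j(n,n';c,M;T) = Σ_{χ mod jn} Σ_{ψ mod jn'} K_j(χ,ψ)·Z_χ(nM;T)·Z_ψ(n'M;T)` —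
a bilinear form in PAIRS of zeros `(ρ_χ, ρ'_ψ)` of DISTINCT Dirichlet L-functions (the kernel is `O(1)` exactly on the
same-L-function pairs), with phases `(nM)^{ρ}(n'M)^{ρ'}` — the q-aspect analogue, at support point
`log M / log j = 2`, of Gonek's weighted pair-correlation form. -/
noncomputable def familyForm (j n n' : ℕ) (c : ℤ) (M : ℕ) (T : ℝ) [NeZero (j * n)] [NeZero (j * n')] : ℂ :=
  ∑ χ : DirichletCharacter ℂ (j * n), ∑ ψ : DirichletCharacter ℂ (j * n'),
    jacobiKernel j n n' c χ ψ * zeroBlock χ ((n : ℝ) * M) T * zeroBlock ψ ((n' : ℝ) * M) T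

/-- THE CARD'S CONJECTURE-GRADE INPUT `FamilyPairDecorrelation η κ`: a power saving `M^{1−κ}` (beyond the operator-norm
/ Cauchy–Schwarz line `M`) in the normalised cross-family pair form, for conductors `jnn' ≤ 2M^{1/2+η}`:
`‖𝓕_j(n,n';c,M; n'M)‖ ≤ C·φ(jn)φ(jn')·M^{1−κ}`.  RMT/`LI`-type independence of the zeros of distinct `L(s,χ)` predicts
square-root cancellation over the `≍ j²nn'` pairs, i.e. the form at `≍ φφ'·M^{3/4}`; the hypothesis asks only `M^{−κ}` of
the available `M^{−1/4}`.  No coset, fan, or correlation of `λ` is mentioned. -/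
def FamilyPairDecorrelation (η κ : ℝ) : Prop :=
  ∀ c : ℤ, c ≠ 0 → ∃ C : ℝ, ∀ (M j n n' : ℕ) [NeZero (j * n)] [NeZero (j * n')], 1 ≤ n → 1 ≤ n' → n ≠ n' →
    ((n : ℝ) * n' ≤ (M : ℝ) ^ η) → Nat.sqrt M + 1 ≤ j → j < 2 * (Nat.sqrt M + 1) →
      ‖familyForm j n n' c M ((n' : ℝ) * M)‖ ≤ C * ((j * n).totient : ℝ) * ((j * n').totient : ℝ) * (M : ℝ) ^ (1 - κ)

/-- THE LINE'S COMPOSITION SHAPE (a `def`, the claim the crux-plan stage would have to build; NOT proved):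
GRH → simple zeros → a negative-moment bound → the explicit formula at precision `q^A X^δ` with `A/2 + δ + η < 1/4` → family pair
decorrelation with some `κ > 0` → the small-dilation coset bound with exponent threshold `η`.  Bookkeeping inside: `CharacterCoordinates`,
the `O(1)`-many non-unit classes per prime factor of `j` (each a one-character sum of length `√M`, GRH-flat), error propagation through the
row lemma (`E·(jV′)^{1/2} ≤ M^{1−κ}`), `ϑ := 1/4 − min(κ, 1/4 − A/2 − δ − η)⁺`. -/
def TransferShape (η : ℝ) : Prop :=
  Literature.NumberTheory.LFunctions.GeneralizedRiemannHypothesis → SimpleZerosFamily → (∃ B : ℝ, NegMomentFamily B) →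
    (∃ A δ : ℝ, 0 ≤ A ∧ 0 ≤ δ ∧ A / 2 + δ + η < 1 / 4 ∧ ClassSumExplicit A δ) →
      (∃ κ : ℝ, 0 < κ ∧ FamilyPairDecorrelation η κ) → SmallDilationCoset η

end Summit.Parity.GeneralizedHardyLittlewood.Cruxes.CosetDecorrelation.JacobiFamily
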